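import Mathlib.Analysis.Complex.Schwarz
import Summits.QuantumFields.BalabanUV.T4Continuum.Support.NE9CurveSpeciesCoupling

/-!
# NE9CurveFromBackgroundMap — the slice-curve binders (c1)–(c3) of leaf A3 for the CURVE species DISCHARGED for curves of
# Bałaban's shape `σ′ ↦ Ψ_X(σ′ • B)`: from the shift field's RAY binders (A3-REM's (d1)–(d2), unchanged) and three TYPE facts about
# the background map Ψ (cell `pub-balaban`, T4-DAG §2 node U3 ∕ §6 NE9; NE9 formalisation swarm, unit
# `b2b-balaban-t4-ne9-formalise-leaf-05` gen 5; own-lineage follow-through of crew row (w20), CLAIMS.log l.11079; at own risk)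

HONEST FRAMING (T4-DAG PAGE 1).  Rung (B)+1 of the FINITE-VOLUME T⁴ programme — existence AND uniqueness of the ε → 0 limit
of gauge-invariant observables on a fixed torus; NOT infinite volume, NOT a mass gap, NOT the Clay problem.  NE9
(`T4OutputRate.NE9` ∧ `FadingMemory`) is a cell NEW ESTIMATE, NOT PRINTED, and is NOT discharged here («NE9 ⇐ the named
binders»); spine 0∕9; 0∕18 skeleton leaves instantiated on Bałaban's objects (O-NE9-1).  HONEST DEPENDENCY (cell line,
verbatim): continuum YM on T⁴ ⇐ BetaPertH ∧ nine spine estimates (0/9 proved); BetaPertH ⇐ (D1) ∧ (D4) ∧ CAP+tail; G-an2-4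
gates asym, D1 and NE2/3/4.  [I] = [Balaban1987RG1] (CMP **109**), [II] = [Balaban1988RG2Cluster] (CMP **116**) are quoted for
TYPES only (ABSOLUTE RULE: nothing printed in the audited series is asserted).  ONE data definition (`RemData.compCur`, a
re-packaging of the owner's FORM-level data), no Prop-valued definition; `FlowStep.BetaPertH`, (B), (B^μ) do not occur.

WHERE THIS SITS.  The owner's located correction O-ne9p1g25-1 (`NE9Lemma1CurveRemainder` ∕ `NE9Lemma1CurveSpecies`): [I] (3.34)
∕ (3.54) expand the old term along the analytic CURVE `σ′ ↦ U_j(□₀, exp iσ′B)|_X` — i.e. along the COMPOSITE of the ray `σ′ ↦ σ′•B`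
in the shift field `B = B(t, s, σ)` of [II] (1.1)∕(1.23) with the BACKGROUND MAP `Ψ_X : B ↦ (chart of) U_j(□₀, exp iB)|_X` of [I]
(3.30)∕(3.37) p. 276–277 (exp ∘ the scale-j minimizer ∘ the group law; linear only for abelian G).  This lineage's (w20) producer
`NE9CurveSpeciesCoupling.cpieceResponse_cur` (p214647) PROVED leaf A3 for the curve species modulo three DISPLAYED slice-curve
binders: (c1) joint continuity on (contours) × {|τ| = 1}, (c2) coupling-Lipschitz displacement `≤ clip·(R_X∕2)·|g k − g′ k|` and (c3)
room `≤ R_X∕2`, both on the inner disc `|τ| < (2c_dir·ℓ k j)⁻¹`.  THIS FILE shows they ask NOTHING of Bałaban's objects beyond the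
RAY species' binders on the shift field (A3-REM p213083: (d1) contour continuity, (d2) coupling-Lipschitz modulus
`clipd·(c_dir·ℓ·R)`, the sizes `dir_le` ∕ `dirB_lt` ∕ `dirB_le` of `RemData.Admissible`) and three TYPE facts about Ψ:
(Ψ1) `Ψ_X` analytic on the field ball `‖B‖ < R_X` ([I] (3.37)), (Ψ2) `Ψ_X` maps it into the chart ball `‖·‖ < R′_X` of U^c_j(X)
where the old terms are analytic ([I] Lemma 4 (3.53) p. 280 — the DOMAIN INCLUSION), (Ψ3) `Ψ_X 0 = 0` (B = 0 gives U_j(□₀, 1),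
the chart centre — our normalisation).  Displayed, asserted for nothing of Bałaban's.
* §1 **`RemData.compCur D Ψ R′`** — the curve datum `cur := τ ↦ Ψ_X(τ • D.dir …)`, `ϱ := R_X∕dirB`, old-term radius `R′`;
  `compCur_id : D.compCur (fun _ => id) D.R = D.toCur` (rfl).
* §2 **`admissible_compCur`** — `D.Admissible` + `0 < dirB` + (Ψ1) + (Ψ2) ⟹ `(D.compCur Ψ R′).Admissible` (Lemma-4 TYPE
  `cur_an` by composition with the ray; the gain letters as in `RemData.Admissible.toCur`).
* §3 the three binders: **`cont_compCur`** (d1) ⟹ (c1); **`lip_compCur`** (d2) ⟹ (c2) with **`clip := 4·clipd`** (leaf-03-g3's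
  `norm_sub_le_of_ball`: Ψ is (4R′∕R)-Lipschitz on the closed R∕2-ball because ‖Ψ‖ < R′ on the R-ball; `|τ|·‖B‖ ≤ R∕2` on the
  inner disc); **`room_compCur`** (c3) FOR FREE from the **SCHWARZ LEMMA between normed spaces** (Mathlib
  `Complex.dist_le_div_mul_dist_of_mapsTo_ball`: (Ψ1)–(Ψ3) ⟹ `‖Ψ z‖ ≤ (R′∕R)·‖z‖`, hence `≤ R′∕2` on the inner disc).
* §4 **`cpieceResponse_compCur`** — `cpieceResponse_cur`'s conclusion for `Dc := D.compCur Ψ R′` from A3-REM's binder list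
  VERBATIM (+ `0 < dirB`) and (Ψ1)–(Ψ3), at a family analytic on the R′-balls with (1.18) `TermSize`; `qc := 64·(4·clipd)·Nbar`.
So, for curves of Bałaban's shape, the curve species' leaf A3 is KERNEL AT FORM LEVEL modulo: the ray species' `RemData.Admissible`
+ (d1)–(d2) + `hhalf` ON THE SHIFT FIELD, (Ψ1)–(Ψ3) ON THE BACKGROUND MAP, analyticity + (1.18) of the family, the counts.  NOT
PRINTED and not claimed: that Bałaban's 𝐇_k, his U_j(□₀, exp iB) and U^c_j meet these binders (O-NE9-1 ∕ O-NE9-5).  DISGUISE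
TEST: last coupling only, one species; no history comparison of terms; not NE9.

WHAT IS PROVED (kernel, `[folklore]`; 0 sorry; 1 data `def`): §1 `compCur_id`; §2 `admissible_compCur`; §3 `norm_le_of_schwarz`,
`norm_smul_le_half`, `cont_compCur`, `lip_compCur`, `room_compCur`; §4 `cpieceResponse_compCur`; §5 one `example`.

References (TYPES only): [Balaban1987RG1] T. Bałaban, CMP **109** (1987) 249–301, (3.30) p. 276, (3.34)∕(3.37) p. 277, Lemma 4
(3.53)–(3.54) p. 280; [Balaban1988RG2Cluster] T. Bałaban, CMP **116** (1988) 1–22, (1.1) p. 3, (1.21)–(1.25) p. 7.  Summits-side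
NEW work (LEAN PLACEMENT RULE); imports this lineage's `NE9CurveSpeciesCoupling` (hence the owner's `NE9Lemma1CurveSpecies`,
leaf-03's `NE9RemainderPieceCoupling`) and Mathlib's Schwarz lemma BY NAME; modifies nothing; no END face re-wired.  Value = the
(w20) binders reduced to ray-field + background-map TYPE facts, NOT summit progress.
-/

noncomputable section

namespace Summit.QuantumFields.BalabanUV.T4Continuum.NE9CurveFromBackgroundMap

open scoped BigOperators
open Metric Set Complex
open Literature.MathematicalPhysics.QuantumFieldTheory.Balaban1983to89
open Literature.MathematicalPhysics.QuantumFieldTheory.Balaban1983to89.T4OutputRate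
open Literature.MathematicalPhysics.QuantumFieldTheory.Balaban1983to89.T4HistoryLipschitzRecursion
open Literature.MathematicalPhysics.QuantumFieldTheory.Balaban1983to89.T4HistoryLipschitzSegment
open Summit.QuantumFields.BalabanUV.T4Continuum.NE9Lemma1PieceClass
open Summit.QuantumFields.BalabanUV.T4Continuum.NE9Lemma1RemainderPiece
open Summit.QuantumFields.BalabanUV.T4Continuum.NE9Lemma1RemainderSpecies
open Summit.QuantumFields.BalabanUV.T4Continuum.NE9Lemma1CurveRemainder
open Summit.QuantumFields.BalabanUV.T4Continuum.NE9Lemma1CurveSpecies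
open Summit.QuantumFields.BalabanUV.T4Continuum.NE9RemainderPieceCoupling (norm_sub_le_of_ball)
open Summit.QuantumFields.BalabanUV.T4Continuum.NE9CurveSpeciesCoupling (cpieceResponse_cur)
open Summit.QuantumFields.BalabanUV.T4Continuum.NE9ComplexEncoding (doubleCarriers)

variable {C : Carriers} {E : Type} [NormedAddCommGroup E] [NormedSpace ℂ E] {ι α β γ δ : Type}

/-! ## §1 The composite curve datum: ray in the shift field, then the background map -/

/-- **THE CURVE DATUM OF BAŁABAN'S SHAPE** built from a ray datum `D` (index families, κ₁, radii r_k, cubes, the shift-field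
DIRECTIONS `D.dir … t s σ` with their size bounds `dirB`, and the FIELD-ball radii `D.R X`), a family of BACKGROUND MAPS
`Ψ X : E → E` (↔ B ↦ the chart of `U_j(□₀, exp iB)|_X`, [I] (3.30)∕(3.37)) and the old terms' analyticity radii `R′ X` (↔ U^c_j(X,
α₀, α₁)): slice curve `τ ↦ Ψ_X(τ • D.dir … t s σ)`, slice radius `ϱ := R_X∕dirB`. [cite: Balaban1987RG1, (3.37) p.277, (3.53) p.280] -/
def _root_.Summit.QuantumFields.BalabanUV.T4Continuum.NE9Lemma1RemainderSpecies.RemData.compCur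
    (D : RemData C E ι α β γ δ) (Ψ : C.Dom → E → E) (R' : C.Dom → ℝ) : CurData C E ι α β γ δ where
  S0 := D.S0
  SY := D.SY
  src := D.src
  Sq := D.Sq
  SX := D.SX
  dY := D.dY
  κ₁ := D.κ₁
  r := D.r
  cubes := D.cubes
  cur := fun k s y a b x t s' σ' τ => Ψ x.1 (τ • D.dir k s y a b x t s' σ')
  R := R'
  ϱ := fun k s y a b x => D.R x.1 / D.dirB k s y a b x

/-- With the identity background map and the same radii the composite datum IS the owner's ray reading `RemData.toCur`
(definitional). [folklore] -/
theorem compCur_id (D : RemData C E ι α β γ δ) : D.compCur (fun _ => id) D.R = D.toCur := rfl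

/-! ## §2 `CurData.Admissible` for the composite datum -/

/-- **THE COMPOSITE DATUM IS ADMISSIBLE** (kernel): from the ray datum's `RemData.Admissible ℓ c_dir d₀` (κ₁ ≥ 1, radii, `dir_le`,
`dirB_lt`, `dirB_le`, source discipline, G1), the displayed strict positivity `0 < dirB` (as in `RemData.Admissible.toCur`), and the
background-map binders (Ψ1) ANALYTIC on the field ball `‖B‖ < R_X` ([I] (3.37) p. 277 — TYPE) and (Ψ2) INTO the old terms' chart
ball `‖·‖ < R′_X` ([I] Lemma 4 (3.53) p. 280 *"(U_j(□₀, exp i(τB + B′)), …)|_X ∈ U^c_j(X, α₀, α₁)"* — TYPE; (Ψ3) is not needed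
here): `(D.compCur Ψ R′).Admissible ℓ c_dir d₀` — `0 < R′_X` because the field ball's image is nonempty; the Lemma-4-type `cur_an` is the composition of Ψ with the ray (`mapsTo_ray`), `ϱ > 1 ⇔
dirB < R`, `ϱ⁻¹ = dirB∕R ≤ c_dir·ℓ`. [cite: Balaban1987RG1, (3.37) p.277, (3.53) p.280; Balaban1988RG2Cluster, (1.25) p.7] -/
theorem admissible_compCur {D : RemData C E ι α β γ δ} {ℓ : ℕ → ℕ → ℝ} {cdir d0 : ℝ} (hD : D.Admissible ℓ cdir d0)
    (hpos : ∀ k s y a b x, 0 < D.dirB k s y a b x) {Ψ : C.Dom → E → E} {R' : C.Dom → ℝ}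
    (hΨan : ∀ X, DifferentiableOn ℂ (Ψ X) (ball 0 (D.R X))) (hΨmaps : ∀ X, MapsTo (Ψ X) (ball 0 (D.R X)) (ball 0 (R' X))) :
    (D.compCur Ψ R').Admissible ℓ cdir d0 where
  κ₁_ge := hD.κ₁_ge
  r_pos := hD.r_pos
  R_pos := fun X => Metric.pos_of_mem_ball (hΨmaps X (mem_ball_self (hD.R_pos X)))
  cur_an := fun k s y a b x t ht s' σ' hsσ =>
    ⟨(hΨan x.1).comp (differentiableOn_ray _ _) (mapsTo_ray (hD.dir_le k s y a b x t ht s' σ' hsσ) (hpos k s y a b x)),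
      (hΨmaps x.1).comp (mapsTo_ray (hD.dir_le k s y a b x t ht s' σ' hsσ) (hpos k s y a b x))⟩
  ϱ_gt := fun k s y a b x => by
    show 1 < D.R x.1 / D.dirB k s y a b x
    rw [lt_div_iff₀ (hpos k s y a b x), one_mul]
    exact hD.dirB_lt k s y a b x
  ϱ_inv_le := fun k s y a ha b hb j x hx => by
    show (D.R x.1 / D.dirB k s y a b x)⁻¹ ≤ cdir * ℓ k j
    rw [inv_div, div_le_iff₀ (hD.R_pos x.1)]
    exact hD.dirB_le k s y a ha b hb j x hx
  srcScale := hD.srcScale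
  G1 := hD.G1
  d0_nonneg := hD.d0_nonneg
  cdir_nonneg := hD.cdir_nonneg

/-! ## §3 The three slice-curve binders of `cpieceResponse_cur` for the composite datum -/

/-- **THE SCHWARZ LEMMA READ FOR THE BACKGROUND MAP**: (Ψ1)–(Ψ3) ⟹ `‖Ψ_X z‖ ≤ (R′_X∕R_X)·‖z‖` on the field ball (Mathlib's Schwarz
lemma between complex normed spaces, `Complex.dist_le_div_mul_dist_of_mapsTo_ball`, at centre 0 with `Ψ_X 0 = 0`). [folklore] -/
theorem norm_le_of_schwarz {Φ : E → E} {R R' : ℝ} (hΦan : DifferentiableOn ℂ Φ (ball 0 R))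
    (hΦmaps : MapsTo Φ (ball 0 R) (ball 0 R')) (hΦ0 : Φ 0 = 0) {z : E} (hz : z ∈ ball (0:E) R) :
    ‖Φ z‖ ≤ R' / R * ‖z‖ := by
  have hmaps' : MapsTo Φ (ball 0 R) (closedBall (Φ 0) R') := by
    rw [hΦ0]; exact hΦmaps.mono_right ball_subset_closedBall
  have h := Complex.dist_le_div_mul_dist_of_mapsTo_ball hΦan hmaps' hz
  rwa [hΦ0, dist_zero_right, dist_zero_right] at h

/-- On the inner disc `|τ| < (2c_dir·ℓ k j)⁻¹` the ray point `τ • B` of a direction of size `≤ c_dir·ℓ k j·R` has norm `≤ R∕2`. [folklore] -/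
theorem norm_smul_le_half {cdir : ℝ} {ℓ : ℕ → ℕ → ℝ} (hcdir : 0 < cdir) (hℓ : ∀ k j, 0 < ℓ k j) {k j : ℕ} {τ : ℂ}
    (hτ : τ ∈ ball (0:ℂ) (1 / (2 * (cdir * ℓ k j)))) {B : E} {R : ℝ} (hB : ‖B‖ ≤ cdir * ℓ k j * R) :
    ‖τ • B‖ ≤ R / 2 := by
  have hcl : 0 < cdir * ℓ k j := mul_pos hcdir (hℓ k j)
  have hc0 : cdir ≠ 0 := hcdir.ne'
  have hℓ0 : ℓ k j ≠ 0 := (hℓ k j).ne'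
  rw [mem_ball_zero_iff] at hτ
  rw [norm_smul]
  calc ‖τ‖ * ‖B‖ ≤ 1 / (2 * (cdir * ℓ k j)) * (cdir * ℓ k j * R) :=
        mul_le_mul hτ.le hB (norm_nonneg _) (by positivity)
    _ = R / 2 := by field_simp

/-- **(d1) ⟹ (c1)**: contour-continuity of the shift-field directions (A3-REM's (d1)) and continuity of the background map on the
field ball ((Ψ1)) give the JOINT continuity of the composite slice-curve family on `(contours) × {|τ| = 1}` (there `‖τ • B‖ = ‖B‖ ≤
dirB < R`, inside the ball). [cite: Balaban1988RG2Cluster, (1.21)-(1.23) p.7; Balaban1987RG1, (3.37) p.277] -/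
theorem cont_compCur {D : RemData C E ι α β γ δ} {ℓ : ℕ → ℕ → ℝ} {cdir d0 : ℝ} (hD : D.Admissible ℓ cdir d0)
    {Ψ : C.Dom → E → E} {R' : C.Dom → ℝ} (hΨan : ∀ X, DifferentiableOn ℂ (Ψ X) (ball 0 (D.R X)))
    (hcont : ∀ (k : ℕ) (s : ℕ → ℝ) (y : ι) (a : α) (b : β) (x : (doubleCarriers C).Dom),
      ContinuousOn (fun p : ℂ × ((δ → ℝ) × (δ → ℂ)) => D.dir k s y a b x p.1 p.2.1 p.2.2)
        (sphere (0:ℂ) (D.r k) ×ˢ {q | OnContour D.κ₁ (D.cubes k y a b) q.1 q.2})) :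
    ∀ (k : ℕ) (s : ℕ → ℝ) (y : ι) (a : α) (b : β) (x : (doubleCarriers C).Dom),
      ContinuousOn (fun q : (ℂ × ((δ → ℝ) × (δ → ℂ))) × ℂ => (D.compCur Ψ R').cur k s y a b x q.1.1 q.1.2.1 q.1.2.2 q.2)
        ((sphere (0:ℂ) ((D.compCur Ψ R').r k) ×ˢ
          {q | OnContour (D.compCur Ψ R').κ₁ ((D.compCur Ψ R').cubes k y a b) q.1 q.2}) ×ˢ sphere (0:ℂ) 1) := by
  intro k s y a b x
  show ContinuousOn (fun q : (ℂ × ((δ → ℝ) × (δ → ℂ))) × ℂ => Ψ x.1 (q.2 • D.dir k s y a b x q.1.1 q.1.2.1 q.1.2.2))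
    ((sphere (0:ℂ) (D.r k) ×ˢ {q | OnContour D.κ₁ (D.cubes k y a b) q.1 q.2}) ×ˢ sphere (0:ℂ) 1)
  have hray : ContinuousOn (fun q : (ℂ × ((δ → ℝ) × (δ → ℂ))) × ℂ => q.2 • D.dir k s y a b x q.1.1 q.1.2.1 q.1.2.2)
      ((sphere (0:ℂ) (D.r k) ×ˢ {q | OnContour D.κ₁ (D.cubes k y a b) q.1 q.2}) ×ˢ sphere (0:ℂ) 1) :=
    continuousOn_snd.smul ((hcont k s y a b x).comp continuousOn_fst fun q hq => hq.1)
  refine (hΨan x.1).continuousOn.comp hray fun q hq => ?_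
  have h1 : ‖q.2‖ = 1 := by simpa using hq.2
  have hdir := hD.dir_le k s y a b x q.1.1 hq.1.1 q.1.2.1 q.1.2.2 hq.1.2
  rw [mem_ball_zero_iff, norm_smul, h1, one_mul]
  exact hdir.trans_lt (hD.dirB_lt k s y a b x)

/-- **(d2) ⟹ (c2) with `clip := 4·clipd`**: the coupling-Lipschitz modulus `clipd·(c_dir·ℓ k j·R_X)·|g k − g′ k|` of the shift-field
directions on the contours (A3-REM's (d2); TYPE [II] (1.21): 𝐇_k(s)B′ is linear in g_k) gives, through the background map — which is
`(4R′∕R)`-Lipschitz on the closed `R∕2`-ball by (Ψ1)–(Ψ2) (`norm_sub_le_of_ball`, sup `< R′`) — the displacement bound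
`‖Ψ(τ•B_g) − Ψ(τ•B_{g′})‖ ≤ (4·clipd)·(R′_X∕2)·|g k − g′ k|` on the inner disc `|τ| < (2c_dirℓ)⁻¹` (where `‖τ•B‖ ≤ R∕2`).
[cite: Balaban1988RG2Cluster, (1.21)-(1.23) p.7; Balaban1987RG1, (3.37) p.277, (3.53) p.280] -/
theorem lip_compCur {D : RemData C E ι α β γ δ} {ℓ : ℕ → ℕ → ℝ} {cdir d0 : ℝ} (hD : D.Admissible ℓ cdir d0)
    {Ψ : C.Dom → E → E} {R' : C.Dom → ℝ} (hΨan : ∀ X, DifferentiableOn ℂ (Ψ X) (ball 0 (D.R X)))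
    (hΨmaps : ∀ X, MapsTo (Ψ X) (ball 0 (D.R X)) (ball 0 (R' X))) {W : Set (ℕ → ℝ)} {clipd : ℝ}
    (hclipd : 0 ≤ clipd) (hcdir : 0 < cdir) (hℓ : ∀ k j, 0 < ℓ k j)
    (hlip : ∀ g ∈ W, ∀ g' ∈ W, ∀ (k : ℕ) (y : ι), ∀ a ∈ D.S0 k y, ∀ b ∈ D.SY k y a, ∀ (j : ℕ), ∀ x ∈ D.src k y a j,
      ∀ t ∈ sphere (0:ℂ) (D.r k), ∀ (s' : δ → ℝ) (σ' : δ → ℂ), OnContour D.κ₁ (D.cubes k y a b) s' σ' →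
        ‖D.dir k g y a b x t s' σ' - D.dir k g' y a b x t s' σ'‖ ≤ clipd * (cdir * ℓ k j * D.R x.1) * |g k - g' k|) :
    ∀ g ∈ W, ∀ g' ∈ W, ∀ (k : ℕ) (y : ι), ∀ a ∈ (D.compCur Ψ R').S0 k y, ∀ b ∈ (D.compCur Ψ R').SY k y a, ∀ (j : ℕ),
      ∀ x ∈ (D.compCur Ψ R').src k y a j, ∀ t ∈ sphere (0:ℂ) ((D.compCur Ψ R').r k), ∀ (s' : δ → ℝ) (σ' : δ → ℂ),
        OnContour (D.compCur Ψ R').κ₁ ((D.compCur Ψ R').cubes k y a b) s' σ' →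
          ∀ τ ∈ ball (0:ℂ) (1 / (2 * (cdir * ℓ k j))),
            ‖(D.compCur Ψ R').cur k g y a b x t s' σ' τ - (D.compCur Ψ R').cur k g' y a b x t s' σ' τ‖ ≤
              4 * clipd * ((D.compCur Ψ R').R x.1 / 2) * |g k - g' k| := by
  intro g hg g' hg' k y a ha b hb j x hx t ht s' σ' hsσ τ hτ
  set X : C.Dom := x.1 with hX
  set R : ℝ := D.R X with hRdef
  show ‖Ψ X (τ • D.dir k g y a b x t s' σ') - Ψ X (τ • D.dir k g' y a b x t s' σ')‖ ≤ 4 * clipd * (R' X / 2) * |g k - g' k|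
  have hRpos : 0 < R := hD.R_pos X
  have hR0 : R ≠ 0 := hRpos.ne'
  -- both ray points lie in the closed R/2-ball
  have hsz : ∀ s : ℕ → ℝ, ‖τ • D.dir k s y a b x t s' σ'‖ ≤ R / 2 := fun s =>
    norm_smul_le_half hcdir hℓ hτ
      ((hD.dir_le k s y a b x t ht s' σ' hsσ).trans (hD.dirB_le k s y a ha b hb j x hx))
  -- the background map is bounded by R′ on the field ball, hence (4R′/R)-Lipschitz on the closed R/2-ball
  have hM : ∀ z ∈ ball (0:E) R, ‖Ψ X z‖ ≤ R' X := fun z hz => (mem_ball_zero_iff.mp (hΨmaps X hz)).le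
  have hhalf' : R / 2 < R := by linarith
  have hL := norm_sub_le_of_ball (hΨan X) hM hhalf' (hsz g) (hsz g')
  -- the displacement of the ray points, from (d2)
  have hτR : ‖τ‖ * (cdir * ℓ k j * R) ≤ R / 2 := by
    have hcl : 0 < cdir * ℓ k j := mul_pos hcdir (hℓ k j)
    have hc0 : cdir ≠ 0 := hcdir.ne'
    have hℓ0 : ℓ k j ≠ 0 := (hℓ k j).ne'
    have hτ' := (mem_ball_zero_iff.mp hτ).le
    calc ‖τ‖ * (cdir * ℓ k j * R) ≤ 1 / (2 * (cdir * ℓ k j)) * (cdir * ℓ k j * R) :=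
          mul_le_mul_of_nonneg_right hτ' (by positivity)
      _ = R / 2 := by field_simp
  have hdisp : ‖τ • D.dir k g y a b x t s' σ' - τ • D.dir k g' y a b x t s' σ'‖ ≤ clipd * (R / 2) * |g k - g' k| := by
    rw [← smul_sub, norm_smul]
    have h := hlip g hg g' hg' k y a ha b hb j x hx t ht s' σ' hsσ
    calc ‖τ‖ * ‖D.dir k g y a b x t s' σ' - D.dir k g' y a b x t s' σ'‖
          ≤ ‖τ‖ * (clipd * (cdir * ℓ k j * R) * |g k - g' k|) := mul_le_mul_of_nonneg_left h (norm_nonneg _)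
      _ = clipd * (‖τ‖ * (cdir * ℓ k j * R)) * |g k - g' k| := by ring
      _ ≤ clipd * (R / 2) * |g k - g' k| :=
          mul_le_mul_of_nonneg_right (mul_le_mul_of_nonneg_left hτR hclipd) (abs_nonneg _)
  have hR'0 : 0 ≤ R' X := (norm_nonneg _).trans (hM 0 (mem_ball_self hRpos))
  have hcoef : 0 ≤ 2 * R' X / (R - R / 2) := div_nonneg (by positivity) (by linarith)
  calc ‖Ψ X (τ • D.dir k g y a b x t s' σ') - Ψ X (τ • D.dir k g' y a b x t s' σ')‖
        ≤ 2 * R' X / (R - R / 2) * ‖τ • D.dir k g y a b x t s' σ' - τ • D.dir k g' y a b x t s' σ'‖ := hL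
    _ ≤ 2 * R' X / (R - R / 2) * (clipd * (R / 2) * |g k - g' k|) := mul_le_mul_of_nonneg_left hdisp hcoef
    _ = 4 * clipd * (R' X / 2) * |g k - g' k| := by
        field_simp
        ring

/-- **(c3) FOR FREE — ROOM FROM THE SCHWARZ LEMMA**: (Ψ1)–(Ψ3) give `‖Ψ_X(τ•B)‖ ≤ (R′∕R)·‖τ•B‖ ≤ R′_X∕2` on the inner disc
`|τ| < (2c_dir·ℓ k j)⁻¹` for directions of size `≤ c_dir·ℓ·R` (A3-REM's `dir_le` ∕ `dirB_le`): the composite curves keep to the inner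
half of the old terms' analyticity ball with NO additional binder. [cite: Balaban1987RG1, (3.37) p.277, (3.53) p.280] -/
theorem room_compCur {D : RemData C E ι α β γ δ} {ℓ : ℕ → ℕ → ℝ} {cdir d0 : ℝ} (hD : D.Admissible ℓ cdir d0)
    {Ψ : C.Dom → E → E} {R' : C.Dom → ℝ} (hΨan : ∀ X, DifferentiableOn ℂ (Ψ X) (ball 0 (D.R X)))
    (hΨmaps : ∀ X, MapsTo (Ψ X) (ball 0 (D.R X)) (ball 0 (R' X))) (hΨ0 : ∀ X, Ψ X 0 = 0)
    (hcdir : 0 < cdir) (hℓ : ∀ k j, 0 < ℓ k j) (W : Set (ℕ → ℝ)) :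
    ∀ g ∈ W, ∀ (k : ℕ) (y : ι), ∀ a ∈ (D.compCur Ψ R').S0 k y, ∀ b ∈ (D.compCur Ψ R').SY k y a, ∀ (j : ℕ),
      ∀ x ∈ (D.compCur Ψ R').src k y a j, ∀ t ∈ sphere (0:ℂ) ((D.compCur Ψ R').r k), ∀ (s' : δ → ℝ) (σ' : δ → ℂ),
        OnContour (D.compCur Ψ R').κ₁ ((D.compCur Ψ R').cubes k y a b) s' σ' →
          ∀ τ ∈ ball (0:ℂ) (1 / (2 * (cdir * ℓ k j))),
            ‖(D.compCur Ψ R').cur k g y a b x t s' σ' τ‖ ≤ (D.compCur Ψ R').R x.1 / 2 := by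
  intro g _ k y a ha b hb j x hx t ht s' σ' hsσ τ hτ
  set X : C.Dom := x.1 with hX
  set R : ℝ := D.R X with hRdef
  show ‖Ψ X (τ • D.dir k g y a b x t s' σ')‖ ≤ R' X / 2
  have hRpos : 0 < R := hD.R_pos X
  have hsz : ‖τ • D.dir k g y a b x t s' σ'‖ ≤ R / 2 :=
    norm_smul_le_half hcdir hℓ hτ
      ((hD.dir_le k g y a b x t ht s' σ' hsσ).trans (hD.dirB_le k g y a ha b hb j x hx))
  have hz : τ • D.dir k g y a b x t s' σ' ∈ ball (0:E) R := by
    rw [mem_ball_zero_iff]; linarith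
  have hR'0 : 0 ≤ R' X := by
    have h := hΨmaps X (mem_ball_self hRpos)
    rw [hΨ0 X, mem_ball_zero_iff, norm_zero] at h
    exact h.le
  calc ‖Ψ X (τ • D.dir k g y a b x t s' σ')‖ ≤ R' X / R * ‖τ • D.dir k g y a b x t s' σ'‖ :=
        norm_le_of_schwarz (hΨan X) (hΨmaps X) (hΨ0 X) hz
    _ ≤ R' X / R * (R / 2) := mul_le_mul_of_nonneg_left hsz (div_nonneg hR'0 hRpos.le)
    _ = R' X / 2 := by field_simp

/-! ## §4 Leaf A3's per-piece coupling response for curves of Bałaban's shape, from ray-field + background-map binders -/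

variable [DecidableEq δ]

/-- **THE PER-PIECE COUPLING RESPONSE FOR CURVES OF BAŁABAN'S SHAPE (kernel; the point of the module).**  For a ray datum `D` with
A3-REM's binder list VERBATIM — `D.Admissible ℓ c_dir d₀`, (d1) `hcont`, (d2) `hlip` with modulus `clipd·(c_dir·ℓ k j·R_X)`, (d3)
`hhalf : c_dir·ℓ k j < ½`, `0 ≤ clipd`, `0 < c_dir`, `0 < ℓ` — plus the displayed `0 < dirB`, a background-map family with (Ψ1)
analytic on the field balls, (Ψ2) into the chart balls of radii `R′`, (Ψ3) `Ψ_X 0 = 0` (TYPE [I] (3.37) p. 277, Lemma 4 (3.53)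
p. 280; asserted for nothing of Bałaban's), and a window family `E g` ANALYTIC on the `R′`-balls with (1.18) `TermSize E W κ N`,
`0 ≤ N j ≤ Nbar`: the conclusion of this lineage's `cpieceResponse_cur` for the composite curve datum `D.compCur Ψ R′` — the `hresp`
binder of `channelCouplingModulus_cpiece` at `P := (D.compCur Ψ R′).toC`, `Kp := (D.compCur Ψ R′).Kp c_dir` (= 64c_dir⁵∕r_k),
gain `ℓ⁵`, **`qc := 64·(4·clipd)·Nbar`**.  Chain: `admissible_compCur`, `cont_compCur`, `lip_compCur`, `room_compCur`, then
`cpieceResponse_cur` with `clip := 4·clipd`.  So (c1)–(c3) ask of Bałaban's objects exactly the ray species' (d1)–(d2) on the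
shift field and (Ψ1)–(Ψ3) on the background map. [cite: Balaban1987RG1, (3.37) p.277, (3.53)-(3.54) p.280; Balaban1988RG2Cluster, (1.21)-(1.25) p.7] -/
theorem cpieceResponse_compCur {D : RemData C E ι α β γ δ} {ℓ : ℕ → ℕ → ℝ} {cdir d0 : ℝ} (hD : D.Admissible ℓ cdir d0)
    (hpos : ∀ k s y a b x, 0 < D.dirB k s y a b x) {Ψ : C.Dom → E → E} {R' : C.Dom → ℝ}
    (hΨan : ∀ X, DifferentiableOn ℂ (Ψ X) (ball 0 (D.R X))) (hΨmaps : ∀ X, MapsTo (Ψ X) (ball 0 (D.R X)) (ball 0 (R' X)))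
    (hΨ0 : ∀ X, Ψ X 0 = 0)
    {Ef : Functional (doubleCarriers C) E} {W : Set (ℕ → ℝ)} {κ : ℝ} {N : ℕ → ℝ} {Nbar clipd : ℝ}
    (hE : ∀ g ∈ W, Ef g ∈ analyticClass R') (hT : TermSize Ef W κ N) (hN0 : ∀ j, 0 ≤ N j) (hNb : ∀ j, N j ≤ Nbar)
    (hclipd : 0 ≤ clipd) (hcdir : 0 < cdir) (hℓ : ∀ k j, 0 < ℓ k j) (hhalf : ∀ k j, cdir * ℓ k j < 1 / 2)
    (hcont : ∀ (k : ℕ) (s : ℕ → ℝ) (y : ι) (a : α) (b : β) (x : (doubleCarriers C).Dom),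
      ContinuousOn (fun p : ℂ × ((δ → ℝ) × (δ → ℂ)) => D.dir k s y a b x p.1 p.2.1 p.2.2)
        (sphere (0:ℂ) (D.r k) ×ˢ {q | OnContour D.κ₁ (D.cubes k y a b) q.1 q.2}))
    (hlip : ∀ g ∈ W, ∀ g' ∈ W, ∀ (k : ℕ) (y : ι), ∀ a ∈ D.S0 k y, ∀ b ∈ D.SY k y a, ∀ (j : ℕ), ∀ x ∈ D.src k y a j,
      ∀ t ∈ sphere (0:ℂ) (D.r k), ∀ (s' : δ → ℝ) (σ' : δ → ℂ), OnContour D.κ₁ (D.cubes k y a b) s' σ' →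
        ‖D.dir k g y a b x t s' σ' - D.dir k g' y a b x t s' σ'‖ ≤ clipd * (cdir * ℓ k j * D.R x.1) * |g k - g' k|) :
    ∀ g ∈ W, ∀ g' ∈ W, ∀ (k : ℕ) (y : ι), ∀ a ∈ (D.compCur Ψ R').toC.S0 k y, ∀ b ∈ (D.compCur Ψ R').toC.SY k y a,
      ∀ (j : ℕ), ∀ x ∈ (D.compCur Ψ R').toC.src k y a j,
      |(D.compCur Ψ R').toC.piece k g y a b x (Ef g) - (D.compCur Ψ R').toC.piece k g' y a b x (Ef g)| ≤
        (D.compCur Ψ R').Kp cdir k y * (64 * (4 * clipd) * Nbar) * ℓ k j ^ 5 * Real.exp (-(κ * (doubleCarriers C).d x)) *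
          Real.exp (-(1 / 8) * ((D.compCur Ψ R').κ₁ - 1) * (D.compCur Ψ R').toC.dY k y + (1 / 8) * (D.compCur Ψ R').κ₁ * d0 -
            (1 / 2) * ((D.compCur Ψ R').κ₁ - 1) * (D.compCur Ψ R').toC.vol k y a b) *
            |g k - g' k| :=
  cpieceResponse_cur (admissible_compCur hD hpos hΨan hΨmaps) hE hT hN0 hNb (by positivity) hcdir hℓ hhalf
    (cont_compCur hD hΨan hcont) (lip_compCur hD hΨan hΨmaps hclipd hcdir hℓ hlip) (room_compCur hD hΨan hΨmaps hΨ0 hcdir hℓ W)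

/-! ## §5 The background-map binders admit genuinely NON-LINEAR maps (sanity `example`) -/

/-- (Ψ1)–(Ψ3) are met by a non-linear map: `Ψ z := z + z²` is analytic on `‖z‖ < ½`, maps that ball into the unit ball
(`‖z + z²‖ ≤ ‖z‖ + ‖z‖² < ¾`), and fixes `0` — so §2–§4 are not confined to rays (the abelian ∕ `compCur_id` case).  A full non-linear
toy DATUM is crew item «CUR-WITNESS» (leaf-09 lineage), not this file. [folklore] -/
example : DifferentiableOn ℂ (fun z : ℂ => z + z ^ 2) (ball 0 (1 / 2)) ∧
    MapsTo (fun z : ℂ => z + z ^ 2) (ball 0 (1 / 2)) (ball 0 1) ∧ (fun z : ℂ => z + z ^ 2) 0 = 0 := by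
  refine ⟨(differentiable_id.add (differentiable_pow 2)).differentiableOn, fun z hz => ?_, by simp⟩
  rw [mem_ball_zero_iff] at hz ⊢
  have h0 : 0 ≤ ‖z‖ := norm_nonneg z
  calc ‖z + z ^ 2‖ ≤ ‖z‖ + ‖z ^ 2‖ := norm_add_le _ _
    _ = ‖z‖ + ‖z‖ ^ 2 := by rw [norm_pow]
    _ < 1 := by nlinarith

end Summit.QuantumFields.BalabanUV.T4Continuum.NE9CurveFromBackgroundMap

end
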